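import Mathlib
import Summits.Ventures.HodgeRepro2.T5LocalNormIndex
import Summits.Ventures.HodgeRepro2.T5RamifiedCharacterCount
import Summits.Ventures.HodgeRepro2.T5RamifiedOddConductor
import Summits.Ventures.HodgeRepro2.T6N5TateTwist
import Summits.Ventures.HodgeRepro2.T6N5Hyp
import Summits.Ventures.HodgeRepro2.T6N5LocalDatum
import Summits.Ventures.HodgeRepro2.T6N5LocalCharDatum
import Summits.Ventures.HodgeRepro2.T6N5LocalRamHyp
import Summits.Ventures.HodgeRepro2.T6N5LocalRam
import Summits.Ventures.HodgeRepro2.T6N5LocalInertCompletion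
import Summits.Ventures.HodgeRepro2.T6N5LocalRamCompletion
import Summits.Ventures.HodgeRepro2.T6N5LocalRamOnCompletion
import Summits.Ventures.HodgeRepro2.T6N5LocalTateChars
import Summits.Ventures.HodgeRepro2.T6N5LocalRamTateSide

/-!
# T6N5LocalRamToyEps — Tier 6, M2 sub-step N5 (t6-p8's half): a model of the ε-factor parameter ON MATHLIB'S
COMPLETIONS at a ramified place satisfying the two printed displays, and conjugate-symplectic characters of both
signs

The per-place statements of record take Tate's ε-factor as a PARAMETER `P : TateParams` constrained only by the
printed displays. For the README §10.5(ii)(c),(d) witness at the completion level one needs a `P` that satisfies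
them on the genuine carriers `L_w^× ⊇ F_v^× = K_v^×` with the genuine conductors. At a ramified place
(`[L_w : K_v] = 2`, `ϖ = u·π²`):
* `epsToy χ ψ dx := (dx / dx_ψ) · ‖π‖^{−m/2} · X(χ)^{−m/2} · χ(π)^m` with `m = n(ψ) + a(χ)`, `X(χ) := χ(u)·c(χ)`,
  `c(χ) := 1` if `χ` is trivial on `F_v^× ∩ O^×` and `η_v(ϖ)` otherwise (`c(χ) = χ(ϖ)` for conjugate-dual `χ` — at
  a ramified place `η_v` is ramified, p4's `exists_mem_adicIntegerUnits_normChar_eq_neg_one`);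
* `toyP` := these parameters with `χ_W` a conjugate-symplectic character of odd conductor (p4's
  `T5RamifiedOddConductor`) and `ϵ_δ(W) = 1`, `Dt ψδ` the toy ramified datum, and the invariance of `m`, `X`, `c`
  under unramified twists.
The two displays and the existence of conjugate-symplectic characters of both signs are proved in
`T6N5LocalRamToyEpsDisplays`.
README §8(d): uses an L-value-free non-vanishing device: NO.
-/

namespace Summit.Ventures.HodgeRepro2.T6.N5LocalRamToyEps

open Summit.Ventures.HodgeRepro2 IsDedekindDomain HeightOneSpectrum
  Summit.Ventures.HodgeRepro2.T6.N5LocalDatum Summit.Ventures.HodgeRepro2.T6.N5LocalCharDatum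
  Summit.Ventures.HodgeRepro2.T6.N5LocalRamDatum Summit.Ventures.HodgeRepro2.T6.N5Local
  Summit.Ventures.HodgeRepro2.T6.N5LocalRam Summit.Ventures.HodgeRepro2.T6.Hyp
  Summit.Ventures.HodgeRepro2.T6.N5LocalInertCompletion Summit.Ventures.HodgeRepro2.T6.N5LocalRamCompletion
  Summit.Ventures.HodgeRepro2.T6.N5LocalRamOnCompletion Summit.Ventures.HodgeRepro2.T6.N5LocalTateChars
  Summit.Ventures.HodgeRepro2.T6.N5LocalRamTateSide Summit.Ventures.HodgeRepro2.T5ConductorArithmetic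

-- `K`, `L` in `Type` (universe `0`).
variable {K : Type} [Field K] [NumberField K] (v : HeightOneSpectrum (NumberField.RingOfIntegers K))
  {L : Type} [Field L] [NumberField L] [Algebra K L] (w : HeightOneSpectrum (NumberField.RingOfIntegers L))
  [w.asIdeal.LiesOver v.asIdeal]

noncomputable section

/-! ### Units of valuation one lie in `Uπ 0` -/

omit [Algebra K L] [w.asIdeal.LiesOver v.asIdeal] in
/-- An element of `L_w^×` of valuation one lies in `Uπ 0 = O_{L_w}^×`. -/
theorem mem_Uπ_zero_of_val_eq_one (π : w.adicCompletionIntegers L) (x : (w.adicCompletion L)ˣ)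
    (hx : Valued.v (x : w.adicCompletion L) = 1) : x ∈ Uπ w π 0 := by
  have hx' : Valued.v ((x⁻¹ : (w.adicCompletion L)ˣ) : w.adicCompletion L) = 1 := by
    rw [Units.val_inv_eq_inv_val, map_inv₀, hx, inv_one]
  let r : (w.adicCompletionIntegers L)ˣ :=
    ⟨⟨(x : w.adicCompletion L), hx.le⟩, ⟨((x⁻¹ : (w.adicCompletion L)ˣ) : w.adicCompletion L), hx'.le⟩,
      Subtype.ext (by simp), Subtype.ext (by simp)⟩
  refine ⟨r, ?_, Units.ext rfl⟩
  show r ∈ T5PrincipalUnitFiltration.higherUnits π 0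
  rw [T5PrincipalUnitFiltration.mem_higherUnits, pow_zero]
  exact one_dvd _

/-- The data of a ramified place: `[L_w : K_v] = 2`, uniformisers `ϖ` of `K_v` and `π` of `L_w`, `ϖ` not a
uniformiser of `L_w` (ramified), and a non-trivial automorphism `σ`. -/
structure RamPlace where
  /-- `[L_w : K_v] = 2`. -/
  h2 : Module.finrank (v.adicCompletion K) (w.adicCompletion L) = 2
  /-- a uniformiser of `K_v` -/
  ϖ : v.adicCompletionIntegers K
  /-- … irreducible -/
  hϖ : Irreducible ϖ
  /-- a uniformiser of `L_w` -/
  π : w.adicCompletionIntegers L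
  /-- … irreducible -/
  hπ : Irreducible π
  /-- the place is ramified: `ϖ` is not a uniformiser of `L_w` -/
  hram : ¬ Irreducible (algebraMap (v.adicCompletionIntegers K) (w.adicCompletionIntegers L) ϖ)
  /-- the non-trivial automorphism -/
  σ : Gal(w.adicCompletion L/v.adicCompletion K)
  /-- … non-trivial -/
  hσ : σ ≠ 1

variable [ContinuousSMul (v.adicCompletion K) (w.adicCompletion L)]
  [IsScalarTower K (v.adicCompletion K) (w.adicCompletion L)]

namespace RamPlace

variable {v w} (Q : RamPlace v w)

omit [ContinuousSMul (v.adicCompletion K) (w.adicCompletion L)]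
  [IsScalarTower K (v.adicCompletion K) (w.adicCompletion L)] in
/-- The norm index `[F_v^× : N L_w^×] = 2` (p4's `T5LocalNormIndex`). -/
theorem hind : (T5AdicCompletionNormGroup.normGroup v w Q.σ).index = 2 :=
  T5LocalNormIndex.index_normGroup_eq_two v w Q.σ Q.h2 Q.hσ

/-! ### The uniformisers and `u = π²/ϖ` -/

/-- The uniformiser of `L_w` as a unit (the datum's `π`). -/
abbrev πU : (w.adicCompletion L)ˣ := T5LocalFieldUnitsDecomposition.uniformizerUnit Q.π Q.hπ

/-- The uniformiser of `K_v` as a unit of `L_w` (an element of `F_v^×`). -/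
abbrev ϖU : (w.adicCompletion L)ˣ :=
  T5UnramifiedCharacter.baseUnits v w (T5AdicCompletionNormGroup.uniformizerUnit v Q.hϖ)

omit [ContinuousSMul (v.adicCompletion K) (w.adicCompletion L)]
  [IsScalarTower K (v.adicCompletion K) (w.adicCompletion L)] in
/-- `ϖ ∈ F_v^×`. -/
theorem ϖU_mem_Fsub : Q.ϖU ∈ Fsub v w := ⟨_, rfl⟩

omit [ContinuousSMul (v.adicCompletion K) (w.adicCompletion L)]
  [IsScalarTower K (v.adicCompletion K) (w.adicCompletion L)] in
/-- `v(π) = exp(−1)`. -/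
theorem val_πU : Valued.v ((Q.πU : (w.adicCompletion L)ˣ) : w.adicCompletion L) = WithZero.exp (-1) :=
  (T5AdicCompletionConductor.irreducible_iff_val_eq_exp_neg_one w Q.π).mp Q.hπ

/-- `v(ϖ) = exp(−2)` in `L_w` (the ramification index is `2`, p4's `val_algebraMap_eq_exp_neg_two`). -/
theorem val_ϖU : Valued.v ((Q.ϖU : (w.adicCompletion L)ˣ) : w.adicCompletion L) = WithZero.exp (-2) := by
  have h := T5RamifiedCharacterCount.val_algebraMap_eq_exp_neg_two v w Q.h2 Q.hϖ Q.hπ Q.hram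
  show Valued.v (algebraMap (v.adicCompletion K) (w.adicCompletion L)
    ((T5AdicCompletionNormGroup.uniformizerUnit v Q.hϖ : (v.adicCompletion K)ˣ) : v.adicCompletion K)) = _
  rw [T5AdicCompletionNormGroup.coe_uniformizerUnit]
  exact h

/-- `u := π²/ϖ`, a unit of `O_{L_w}`. -/
def uU : (w.adicCompletion L)ˣ := Q.πU ^ 2 * Q.ϖU⁻¹

omit [ContinuousSMul (v.adicCompletion K) (w.adicCompletion L)]
  [IsScalarTower K (v.adicCompletion K) (w.adicCompletion L)] in
/-- `π² = u·ϖ`. -/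
theorem πU_sq : Q.πU ^ 2 = Q.uU * Q.ϖU := by
  unfold uU
  rw [mul_assoc, inv_mul_cancel, mul_one]

/-- `v(u) = 1`. -/
theorem val_uU : Valued.v ((Q.uU : (w.adicCompletion L)ˣ) : w.adicCompletion L) = 1 := by
  unfold uU
  rw [Units.val_mul, Units.val_pow_eq_pow_val, map_mul, map_pow, Q.val_πU, Units.val_inv_eq_inv_val, map_inv₀,
    Q.val_ϖU, ← WithZero.exp_nsmul]
  norm_num

/-- `u ∈ Uπ 0 = O_{L_w}^×`. -/
theorem uU_mem_U0 : Q.uU ∈ Uπ w Q.π 0 :=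
  mem_Uπ_zero_of_val_eq_one w Q.π _ Q.val_uU

/-! ### `η_v` is ramified: a unit of `F_v^×` with `η_v = −1` -/

omit [IsScalarTower K (v.adicCompletion K) (w.adicCompletion L)] in
/-- At a ramified place there is a unit `f ∈ F_v^× ∩ Uπ 0` with `η_v(f) = −1`. -/
theorem exists_mem_Fsub_inf_ηF_eq_neg_one :
    ∃ f : Fsub v w, (f : (w.adicCompletion L)ˣ) ∈ Uπ w Q.π 0 ∧ ηF v w Q.σ Q.hind f = -1 := by
  obtain ⟨u, hu, hu1⟩ :=
    T5LocalNormIndex.exists_mem_adicIntegerUnits_normChar_eq_neg_one v w Q.σ Q.h2 Q.hσ Q.hϖ Q.hπ Q.hram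
  obtain ⟨s, hs⟩ := hu
  have hval : Valued.v (u : v.adicCompletion K) = 1 := by
    rw [← hs]
    exact T5AdicCompletionNormSurjective.val_coe_units_eq_one v s
  refine ⟨⟨T5UnramifiedCharacter.baseUnits v w u, ⟨u, rfl⟩⟩, baseUnits_mem_Uπ_zero v w Q.π u hval, ?_⟩
  rw [ηF_baseUnits, hu1]
  exact Units.ext (by simp)

/-! ### The toy ε-factor -/

open Classical in
/-- `c(χ) := 1` if `χ` is trivial on `F_v^× ∩ O^×`, `η_v(ϖ)` otherwise. -/
def cF (χ : (w.adicCompletion L)ˣ →* ℂˣ) : ℂ :=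
  if ∀ x ∈ Fsub v w ⊓ Uπ w Q.π 0, χ x = 1 then 1
  else ((ηF v w Q.σ Q.hind ⟨Q.ϖU, Q.ϖU_mem_Fsub⟩ : ℂˣ) : ℂ)

omit [ContinuousSMul (v.adicCompletion K) (w.adicCompletion L)]
  [IsScalarTower K (v.adicCompletion K) (w.adicCompletion L)] in
/-- `c(χ) ≠ 0`. -/
theorem cF_ne_zero (χ : (w.adicCompletion L)ˣ →* ℂˣ) : Q.cF χ ≠ 0 := by
  unfold cF
  split_ifs
  · exact one_ne_zero
  · exact Units.ne_zero _

/-- `X(χ) := χ(u)·c(χ)`. -/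
def Xc (χ : (w.adicCompletion L)ˣ →* ℂˣ) : ℂ := ((χ Q.uU : ℂˣ) : ℂ) * Q.cF χ

omit [ContinuousSMul (v.adicCompletion K) (w.adicCompletion L)]
  [IsScalarTower K (v.adicCompletion K) (w.adicCompletion L)] in
/-- `X(χ) ≠ 0`. -/
theorem Xc_ne_zero (χ : (w.adicCompletion L)ˣ →* ℂˣ) : Q.Xc χ ≠ 0 :=
  mul_ne_zero (Units.ne_zero _) (Q.cF_ne_zero χ)

/-- `m(χ, ψ) := n(ψ) + a(χ)`. -/
def mm (χ : (w.adicCompletion L)ˣ →* ℂˣ) (ψ : PsiC w) : ℤ := cond w ψ + (conductor (Uπ w Q.π) χ : ℤ)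

/-- `‖π‖^{1/2}`. -/
def nh : ℂ := ((nrm w Q.πU : ℝ) : ℂ) ^ (1 / 2 : ℂ)

omit [ContinuousSMul (v.adicCompletion K) (w.adicCompletion L)]
  [IsScalarTower K (v.adicCompletion K) (w.adicCompletion L)] in
/-- `‖π‖^{1/2} ≠ 0`. -/
theorem nh_ne_zero : Q.nh ≠ 0 := nrm_cpow_ne_zero w (1 / 2) _

/-- The toy ε-factor: `ε(χ, ψ, dx) := (dx/dx_ψ) · ‖π‖^{−m/2} · X(χ)^{−m/2} · χ(π)^m`, `m = n(ψ) + a(χ)`. -/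
def epsToy (χ : (w.adicCompletion L)ˣ →* ℂˣ) (ψ : PsiC w) (dx : ℝ) : ℂ :=
  ((dx / sd w ψ : ℝ) : ℂ) * Q.nh ^ (-(Q.mm χ ψ)) * Q.Xc χ ^ (-(Q.mm χ ψ : ℂ) / 2) *
    ((χ Q.πU : ℂˣ) : ℂ) ^ (Q.mm χ ψ)

/-- The conjugate-symplectic character of odd conductor (p4's `T5RamifiedOddConductor`), chosen. -/
def χWt : (w.adicCompletion L)ˣ →* ℂˣ :=
  Classical.choose (T5RamifiedOddConductor.exists_CS_odd_level_of_ramified' v w Q.h2 Q.hϖ Q.hπ Q.hram Q.σ Q.hσ)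

omit [ContinuousSMul (v.adicCompletion K) (w.adicCompletion L)] in
/-- Its properties: conjugate-symplectic, smooth, of odd conductor. -/
theorem χWt_spec :
    (∀ f : Fsub v w, Q.χWt f = ηF v w Q.σ Q.hind f) ∧ (∃ m, Uπ w Q.π m ≤ Q.χWt.ker) ∧
      Odd (conductor (Uπ w Q.π) Q.χWt) :=
  Classical.choose_spec (T5RamifiedOddConductor.exists_CS_odd_level_of_ramified' v w Q.h2 Q.hϖ Q.hπ Q.hram Q.σ Q.hσ)

/-- The toy parameters: the toy ε-factor, `χ_W := χWt`, `ϵ_δ(W) = 1`, the theta predicate (replaced by the carried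
Weil representation downstream), the line signs. -/
def toyP : TateParams (w.adicCompletion L)ˣ (PsiC w) ℝ where
  epsT := Q.epsToy
  χW := Q.χWt
  epsdW := 1
  Theta := fun _ _ => True
  ηLine := fun _ => 1
  ηu := 1

/-- The toy ramified datum over a given `ψ_δ`. -/
abbrev Dt (ψδ : PsiC w) : RamifiedSignDatum :=
  mkRam v w Q.hπ Q.σ Q.hind (mkTateSideRam v w Q.σ Q.toyP ψδ)

/-! ### Invariance under unramified twists -/

/-- `X(χω) = X(χ)` for `ω` trivial on `Uπ 0`. -/
theorem Xc_mul_of_unramified (χ ω : (w.adicCompletion L)ˣ →* ℂˣ) (hω : Uπ w Q.π 0 ≤ ω.ker) :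
    Q.Xc (χ * ω) = Q.Xc χ := by
  classical
  have hω' : ∀ x ∈ Uπ w Q.π 0, ω x = 1 := fun x hx => MonoidHom.mem_ker.mp (hω hx)
  unfold Xc cF
  have hu : (χ * ω) Q.uU = χ Q.uU := by
    rw [MonoidHom.mul_apply, hω' _ Q.uU_mem_U0, mul_one]
  have hiff : (∀ x ∈ Fsub v w ⊓ Uπ w Q.π 0, (χ * ω) x = 1) ↔ (∀ x ∈ Fsub v w ⊓ Uπ w Q.π 0, χ x = 1) := by
    constructor
    · intro h x hx
      have := h x hx
      rwa [MonoidHom.mul_apply, hω' x hx.2, mul_one] at this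
    · intro h x hx
      rw [MonoidHom.mul_apply, hω' x hx.2, mul_one]
      exact h x hx
  rw [hu]
  congr 1
  exact if_congr hiff rfl rfl

omit [ContinuousSMul (v.adicCompletion K) (w.adicCompletion L)] in
/-- `a(χω) = a(χ)` for smooth `χ` and `ω` trivial on `Uπ 0` (`CharDatum.cond_mul_of_isUnramified` on the toy
datum). -/
theorem conductor_mul_of_unramified (ψδ : PsiC w) (χ ω : (w.adicCompletion L)ˣ →* ℂˣ)
    (hχ : ∃ n, Uπ w Q.π n ≤ χ.ker) (hω : Uπ w Q.π 0 ≤ ω.ker) :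
    conductor (Uπ w Q.π) (χ * ω) = conductor (Uπ w Q.π) χ :=
  CharDatum.cond_mul_of_isUnramified (Q.Dt ψδ).toCharDatum (Uπ_antitone w Q.π) hχ hω

omit [ContinuousSMul (v.adicCompletion K) (w.adicCompletion L)] in
/-- `m(χω, ψ) = m(χ, ψ)` for smooth `χ` and `ω` trivial on `Uπ 0`. -/
theorem mm_mul_of_unramified (ψδ : PsiC w) (χ ω : (w.adicCompletion L)ˣ →* ℂˣ)
    (hχ : ∃ n, Uπ w Q.π n ≤ χ.ker) (hω : Uπ w Q.π 0 ≤ ω.ker) (ψ : PsiC w) :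
    Q.mm (χ * ω) ψ = Q.mm χ ψ := by
  unfold mm
  rw [Q.conductor_mul_of_unramified ψδ χ ω hχ hω]

end RamPlace

end

end Summit.Ventures.HodgeRepro2.T6.N5LocalRamToyEps
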